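import Summits.RiemannHypothesis.RiemannHypothesis.Theorems.WeilTwoPrimeDeflM78FBase
import Summits.RiemannHypothesis.RiemannHypothesis.Theorems.WeilTwoPrimeDeflM78FDataR
import Literature.NumberTheory.LFunctions.WeilTwoPrimeCellsT120
import Literature.NumberTheory.LFunctions.WeilTwoPrimeCertificateDeflated
import HarnessLib

/-!
# Deflated two-prime certificate M78F: the certificate `weilCertDeflM78F : WeilCert23` and its augmented coefficient matrix

`weilCertDeflM78F` = base `weilCertDeflM78FBase` + `j = 5` + `pnu = 64` + the cells `weilTwoPrimeCellsT120` + support `b = 39/50` + the table `weilCertDeflM78FNu`; penalty data `weilCertDeflM78FR`; `weilCertDeflM78FP = P_r + Σ μ ĉ ĉᵀ`. [cite: Yoshida1992, §6, Thm 1 p. 310] Data only.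
-/

noncomputable section

set_option linter.dupNamespace false

namespace Summit.RiemannHypothesis.RiemannHypothesis.Theorems.EvenWinsBeyondArch

open Literature.NumberTheory.LFunctions

/-- **The deflated two-prime certificate M78F** (`a₀ = b = 39/50`, `N = 255`, `T = 120`, `β₂₃ = 16/25`, k_odd = 6). [folklore] -/
def weilCertDeflM78F : WeilCert23 := ⟨weilCertDeflM78FBase, 5, 64, weilTwoPrimeCellsT120, 39/50, weilCertDeflM78FNu⟩

/-- The base of `weilCertDeflM78F` is `weilCertDeflM78FBase` (definitional). [folklore] -/
theorem weilCertDeflM78F_base : weilCertDeflM78F.base = weilCertDeflM78FBase := rfl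

/-- The table of `weilCertDeflM78F` is `weilCertDeflM78FNu` (definitional). [folklore] -/
theorem weilCertDeflM78F_nuTab : weilCertDeflM78F.nuTab = weilCertDeflM78FNu := rfl

/-- The augmented coefficient matrix `P_r + Σ μ ĉ ĉᵀ` of certificate M78F. [folklore] -/
def weilCertDeflM78FP (k l : ℕ) : ℚ := weilCertDeflM78FBase.prQ weilCertDeflM78FNu k l + rankOneQ weilCertDeflM78FR k l

/-- `weilCertDeflM78FP` is the augmented matrix of the certificate (definitional). [folklore] -/
theorem weilCertDeflM78FP_eq : weilCertDeflM78FP = fun k l ↦ weilCertDeflM78F.base.prQ weilCertDeflM78F.nuTab k l + rankOneQ weilCertDeflM78FR k l := rfl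

end Summit.RiemannHypothesis.RiemannHypothesis.Theorems.EvenWinsBeyondArch
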